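import Summits.KontsevichZagierPeriods.Zeta5Search.WedgeDictionaryLevelDescentVFullRel3Cert
import Summits.KontsevichZagierPeriods.Zeta5Search.WedgeDictionaryLevelDescentVFullDescentSwap
import HarnessLib

/-!
# REL-(3) summed: `ldY_rel3_stmt` holds, hence `levelDescentVFull` (T3 descent, final step)

HONEST FRAMING: "systematic search; no irrationality claim unless certified".

Summing the termwise certificate identity of `WedgeDictionaryLevelDescentVFullRel3Cert` over `μ = 1..N` telescopes to
`Cert_{N+1} − Cert_1`; `Cert_{N+1} = 0` because the combined weight vanishes above the support (`ldCw_top`), and `Cert_1 = 0`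
because `m₀(1) = c₁₂·p₁(0)`, `PB(1) = p₂(0)` and REC-K extends to `μ = 0`: `p₂(0)K₂ + p₁(0)K₁ = 0` (`ldKer_recK_zero`, from the
explicit `K₁` (`ldKer_one`, `…VFullLayer0`), `K₂`, the kernel ratio `kernel5_succ4` and the polynomial identity `(N+3)p₁(0) + p₂(0) = ∏_B(1+b_j)` —
eng-exactrec-1 `rel3_boundary`).  Consequences:

* `ldY_rel3_holds : ldY_rel3_stmt` — the slot-1 three-term relation of `Y = (d+1)·SE(b) − Π₂·SE(b−e₂)`;
* `levelDescentVFull_holds : levelDescentVFull` — by `levelDescentVFull_of_rel3` (`…VFullDescentSwap`), i.e. the boundary-corrected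
  level-descent identity on the unclean cone is now a theorem (std axioms), closing the chain
  `…VFull → …VFullFirstLayer → …VFullDescent(Lemmas/Swap) → KModule/CwRatio/RecK → Rel3Cert → here`;
* (T3) `ldSE_rowSource_holds : ldSE_rowSource_stmt` (by `ldSE_rowSource_of_rel3`), and its two proved-equivalent forms
  `ldSE_rowSource_explicit_holds`, `ldSE_rowSource_zoneZ_holds` (transfers of `…VFullZoneZ`).

What this is NOT: anything about irrationality; the remaining conjecture leaves of the wedge dictionary (`wedgeDictionary` ⟺
`wedgeDictionaryIntegralPart`, and `wedgeDictionaryFull` — the cellular-integral half) are untouched.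
-/

open Finset

namespace Summit.KontsevichZagierPeriods.Zeta5Search.WedgeDictionary

open Summit.KontsevichZagierPeriods.Zeta5Search.DualSeries

/-! ## REC-K at `μ = 0` -/

/-- `(z)₂ = z(z+1)`. -/
theorem pochQ_two (z : ℚ) : pochQ z 2 = z * (z + 1) := by simp [pochQ, prod_range_succ]

/-- `K₂ = k₅(1)/((N+2)(N+3)) − k₅(2)/((N+3)(N+4))`. -/
theorem ldKer_two (b : ℕ → ℤ) :
    ldKer b 2 = kernel5 b 1 / (((b 0 : ℚ) + 2) * ((b 0 : ℚ) + 3)) - kernel5 b 2 / (((b 0 : ℚ) + 3) * ((b 0 : ℚ) + 4)) := by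
  rw [ldKer, sum_Icc_succ_top (by norm_num : 1 ≤ 2), Icc_self, sum_singleton]
  simp only [Nat.reduceSub, Nat.sub_self, Nat.factorial_zero, Nat.factorial_one, Nat.cast_one, pow_zero, one_mul, mul_one,
    pochQ_two]
  ring

/-- REC-K at `μ = 0` (eng-exactrec-1 `rel3_boundary`): `p₂(0)·K₂ + p₁(0)·K₁ = 0`. -/
theorem ldKer_recK_zero (b : ℕ → ℤ) (hN : 0 ≤ b 0) (hB : ∀ j ∈ Icc 3 6, 0 ≤ b j ∧ b j ≤ b 0) :
    kerP2 b 0 * ldKer b 2 + kerP1 b 0 * ldKer b 1 = 0 := by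
  have hB' := hB
  simp only [mem_Icc] at hB'
  have h3 := hB' 3 (by norm_num); have h4 := hB' 4 (by norm_num); have h5 := hB' 5 (by norm_num)
  have h6 := hB' 6 (by norm_num)
  have hn2 : (b 0 : ℚ) + 2 ≠ 0 := ne_zero_of_eq_intCast _ (by push_cast; ring) (show (0 : ℤ) < b 0 + 2 by omega)
  have hn3 : (b 0 : ℚ) + 3 ≠ 0 := ne_zero_of_eq_intCast _ (by push_cast; ring) (show (0 : ℤ) < b 0 + 3 by omega)
  have hn4 : (b 0 : ℚ) + 4 ≠ 0 := ne_zero_of_eq_intCast _ (by push_cast; ring) (show (0 : ℤ) < b 0 + 4 by omega)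
  have h54 := kernel5_succ4 b 1 le_rfl hN hB
  push_cast at h54
  have h54' : kernel5 b 2 * (((b 0 : ℚ) + 2) * kerP2 b 0) =
      kernel5 b 1 * (((b 0 : ℚ) + 4) * ((1 + (b 3 : ℚ)) * (1 + (b 4 : ℚ)) * (1 + (b 5 : ℚ)) * (1 + (b 6 : ℚ)))) := by
    simp only [kerP2]; push_cast; linear_combination h54
  have hbd : ((b 0 : ℚ) + 3) * kerP1 b 0 + kerP2 b 0 -
      (1 + (b 3 : ℚ)) * (1 + (b 4 : ℚ)) * (1 + (b 5 : ℚ)) * (1 + (b 6 : ℚ)) = 0 := by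
    simp only [kerP1, kerP2, esB1, esB2, esB3]; push_cast; ring
  have hK1 : ldKer b 1 * ((b 0 : ℚ) + 2) = kernel5 b 1 := by rw [ldKer_one, div_mul_cancel₀ _ hn2]
  have hK2 : ldKer b 2 * (((b 0 : ℚ) + 2) * ((b 0 : ℚ) + 3) * ((b 0 : ℚ) + 4)) =
      kernel5 b 1 * ((b 0 : ℚ) + 4) - kernel5 b 2 * ((b 0 : ℚ) + 2) := by
    rw [ldKer_two]; field_simp
  have hM : (((b 0 : ℚ) + 2) * ((b 0 : ℚ) + 3) * ((b 0 : ℚ) + 4)) * (((b 0 : ℚ) + 2) * kerP2 b 0) ≠ 0 :=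
    ne_zero_of_eq_intCast _ (by simp only [kerP2]; push_cast; ring)
      (show (0 : ℤ) < (b 0 + 2) * (b 0 + 3) * (b 0 + 4) *
          ((b 0 + 2) * ((b 0 + 2 - b 3) * (b 0 + 2 - b 4) * (b 0 + 2 - b 5) * (b 0 + 2 - b 6))) from
        mul_pos (mul_pos (mul_pos (by omega) (by omega)) (by omega))
          (mul_pos (by omega) (mul_pos (mul_pos (mul_pos (by omega) (by omega)) (by omega)) (by omega))))
  have hW : (kerP2 b 0 * ldKer b 2 + kerP1 b 0 * ldKer b 1) *
      ((((b 0 : ℚ) + 2) * ((b 0 : ℚ) + 3) * ((b 0 : ℚ) + 4)) * (((b 0 : ℚ) + 2) * kerP2 b 0)) = 0 := by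
    linear_combination (kerP2 b 0 * (((b 0 : ℚ) + 2) * kerP2 b 0)) * hK2 +
      (kerP1 b 0 * (((b 0 : ℚ) + 3) * ((b 0 : ℚ) + 4)) * (((b 0 : ℚ) + 2) * kerP2 b 0)) * hK1 +
      (-(kerP2 b 0 * ((b 0 : ℚ) + 2))) * h54' +
      (kerP2 b 0 * ((b 0 : ℚ) + 2) * ((b 0 : ℚ) + 4) * kernel5 b 1) * hbd
  exact (mul_eq_zero.mp hW).resolve_right hM

/-! ## Boundary values of the certificate -/

/-- `Cert_1 = 0`. -/
theorem certK_one (b : ℕ → ℤ) (hN : 0 ≤ b 0) (hB : ∀ j ∈ Icc 3 6, 0 ≤ b j ∧ b j ≤ b 0) : certK b 1 = 0 := by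
  have h0 := ldKer_recK_zero b hN hB
  have hM1 : certM0 b 1 = ((b 0 : ℚ) - b 1 - b 2) * kerP1 b 0 := by
    rw [kerP1_eq]; simp only [certM0, Nat.cast_zero, sub_self, zero_mul, sub_zero, add_sub_cancel_right]
  have hP : ldPB b 1 = kerP2 b 0 := by rw [kerP2_eq_ldPB]
  rw [certK, certKn]
  apply div_eq_zero_iff.mpr
  left
  simp only [Nat.cast_one, Nat.reduceAdd, hM1, hP]
  linear_combination (ldCw b 1 * ((b 2 : ℚ) + 1) * ldPc b * ldR1 b * ldR2 b * ((b 0 : ℚ) - b 1 - b 2)) * h0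

/-- `Cert_{N+1} = 0`. -/
theorem certK_top (b : ℕ → ℤ) (h1 : 0 ≤ b 1) (h2 : 1 ≤ b 2) (h7 : 0 ≤ b 7) : certK b ((b 0).toNat + 1) = 0 := by
  rw [certK, certKn, ldCw_top b h1 h2 h7]
  simp

/-! ## The relation and the level descent -/

/-- REL-(3) for `Y`: `d·Y(b+2e₁) + Γ₁r₂·Y(b+e₁) + Γ₀r₁r₂·Y(b) = 0` on admissible rows with `c₁₂ ≥ 1`, `b₂ ≥ 1`, `b₇ = 0`. -/
theorem ldY_rel3_holds : ldY_rel3_stmt := by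
  intro b hN hbox hB _hd hb2 hb7 hc
  obtain ⟨e0, -, -, -, -, -, -, -⟩ := bump0_vals b
  obtain ⟨f0, -, -, -, -, -, -, -⟩ := bump0_vals (bump b 0)
  have hbox' := hbox
  simp only [mem_Icc] at hbox'
  have hx1 := hbox' 1 (by norm_num)
  have hBK : ∀ j ∈ Icc 3 6, 0 ≤ b j ∧ b j ≤ b 0 := fun j hj => by
    have hj' := hj; simp only [mem_Icc] at hj'; exact hbox j (by simp only [mem_Icc]; omega)
  have key : ∀ μ ∈ Icc 1 (b 0).toNat,
      (dOf b : ℚ) * (ldCw (bump (bump b 0) 0) μ * ldKer b μ) +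
            faceGamma1 b 0 * (((b 1 : ℚ) + 2) * ((b 0 : ℚ) - b 1 - 1)) * (ldCw (bump b 0) μ * ldKer b μ) +
          faceGamma0 b 0 * ((((b 1 : ℚ) + 1) * ((b 0 : ℚ) - b 1)) * (((b 1 : ℚ) + 2) * ((b 0 : ℚ) - b 1 - 1))) *
            (ldCw b μ * ldKer b μ) =
        certK b (μ + 1) - certK b μ := by
    intro μ hμ
    have hμ' : 1 ≤ μ := by simp only [mem_Icc] at hμ; exact hμ.1
    rw [← rel3_termwise b hN hbox hB hb2 hb7 hc μ hμ']
    simp only [rel3T, ldR1, ldR2]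
    ring
  rw [ldY_eq_sum, ldY_eq_sum, ldY_eq_sum, f0, e0]
  simp only [ldKer_bump0]
  rw [mul_sum, mul_sum, mul_sum, ← sum_add_distrib, ← sum_add_distrib, sum_congr rfl key,
    sum_Icc_one_telescope (certK b) (b 0).toNat, certK_top b hx1.1 hb2 (by omega), certK_one b hN hBK, sub_self]

/-- LEVEL DESCENT ON THE UNCLEAN CONE: `levelDescentVFull` holds. -/
theorem levelDescentVFull_holds : levelDescentVFull := levelDescentVFull_of_rel3 ldY_rel3_holds

/-- (T3) `ldSE_rowSource_stmt` (the row identity `(d+1)·SE(b) − Π₂·SE(b−e₂) = η(b−e₂)·U(b)`) holds. -/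
theorem ldSE_rowSource_holds : ldSE_rowSource_stmt := ldSE_rowSource_of_rel3 ldY_rel3_holds

/-- (T3) in its explicit finite-sum form (`…VFullZoneZ`) holds. -/
theorem ldSE_rowSource_explicit_holds : ldSE_rowSource_explicit_stmt :=
  (show ldSE_rowSource_explicit_stmt ↔ ldSE_rowSource_stmt from rows_transfer_holds).mpr ldSE_rowSource_holds

/-- (T3|Z) (`…VFullZoneZ`) holds. -/
theorem ldSE_rowSource_zoneZ_holds : ldSE_rowSource_zoneZ_stmt :=
  (show ldSE_rowSource_zoneZ_stmt ↔ _ from zoneZ_transfer_holds).mpr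
    fun b h0 hS hB hd h2 h7 h12 _ => ldSE_rowSource_holds b h0 hS hB hd h2 h7 h12

end Summit.KontsevichZagierPeriods.Zeta5Search.WedgeDictionary
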